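import Literature.NumberTheory.LFunctions.Zhang2022.KnifeEdgeJumpTerm
import Literature.NumberTheory.LFunctions.Zhang2022.RepairRplusTightness

/-!
# Zhang (2022) §18-margin repair rung — barrier extension for B-multi sub-class M1 (INTERIOR JUMPS):
# the family `familyJumpBlock κ` wrapping `KnifeEdgeJumpTerm` (p458438) into the `R⁺⁺` protocol

Trunk T-ANT (NumberTheory/LFunctions). Y. Zhang, *Discrete mean estimates and the Landau–Siegel
zero*, arXiv:2211.02515v1 (2022) [Zhang2022LandauSiegel] — **an unrefereed manuscript under
adjudication. WHAT THIS IS NOT: nothing here asserts or denies its Theorems 1–2 or any analytic lemma;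
no claim about Landau–Siegel zeros, about Parity, or about a repaired `Margin232` is made. Every
statement below is about a MODEL main-term functional of the manuscript's method as architected, not
about zeros of `L`-functions.** Cell `landau-siegel` (rung F-S3), sub-cell E (barrier extension), seat p4,
stub S-E-p4-3 of `barrier/ASSIGNMENTS.md` v1.19 (writer ls-barrier-plan, 18:00Z): «§E WRAP of B-multi M1 =
interior jumps — `Repair.familyJumpBlock (κ)`: Design = `J : KnifeEdge.JumpData`, K := `J.Admissible`;
Verdict := `(∀ z ∈ Ioo 0 1, 0 ≤ κ z) → 0 ≤ jumpMainTerm κ J` (slot DISPLAYED, kind (c) = the E-028 kernel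
sign), by `jumpMainTerm_nonneg`; `familyJumpBlock_decided`, `rplus_jump_decided`; C2
`jumpMainTerm_of_isEmpty`; C4 witnesses = B-multi designs multi-jump-001/002; tightness
`exists_kernel_neg_of_jumpCloses`». Extension protocol of `RepairRplus` (p455670).

## The class (sub-class M1 of B-multi/PLAN.md; typed objects of ls-Bmulti-typer-2's p458438)

A design is a jump datum `J : KnifeEdge.JumpData` — a continuous part `u = J.cont` with marked right
derivative `u′ = J.cont'` and `J.n` sharp steps `c_i·Λ^{−1/2}·𝟙_{[0,z_i)}` (balanced amplitudes
`c_i = J.coef i`, heights `z_i = J.pos i`). Membership `K := J.Admissible`: `u` a one-sided kinked profile on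
`[0,1]` (`Repair.KinkedProfile u u′`, `u(1) = 0` — inside the validated calculus) and EVERY jump INTERIOR,
`0 < z_i < 1` (a jump AT the wall `z = 1` is the band/wall row E-005/E-034 of B-multi M3, not this class).
No analytic hypothesis is folded into `K`.

## The verdict, its currency, and the displayed slot (C3)

Verdict of `familyJumpBlock κ` on `J`: **`(∀ z ∈ Ioo 0 1, 0 ≤ κ z) → 0 ≤ jumpMainTerm κ J`**, where
`KnifeEdge.jumpMainTerm κ J = 𝔅(u) + Σ_i ‖c_i‖²·κ(z_i)` is the BALANCED main-order constant (units `𝔞𝔓`)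
that registry row E-028 (`KnifeEdge.EMultiJump c' κ Λ`, B-multi alias multi-E1 «E-multi-jump(h, z₀)»;
status: derivation, in-house, unreviewed) CLAIMS for the discrete mean of the balanced profile polynomial.
CURRENCY (C3(e)): an (A)-world MODEL main term in the balanced reading — the theorem is about the functional
`jumpMainTerm κ J` for an ARBITRARY kernel parameter `κ : ℝ → ℝ`; that this functional IS the main term of the
discrete mean is E-028 itself (open: `κ` and the balancing scale `Λ` have no closed form in print or in the
cell's files; definition request D-multi-2 `jumpKappa` to ls-theory). The DISPLAYED slot (kind (c)) is the
kernel sign `∀ z ∈ (0,1), 0 ≤ κ z` (the row's informal claim «`κ(z₀) > 0`, explicit: a `|·|²` trivial-diagonal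
term», typed as `KnifeEdge.JumpKernelPos κ`); when theory's closed form lands with its positivity proved,
the slot DISCHARGES (`familyJumpBlock_verdict_of_jumpKernelPos`) and M1 is decided with nothing displayed.
The fixed-height (literal) reading — jump variance `≍ |η|²𝓛^{1.1}` dominating the dipole-suppressed regular
part `≍ 𝔞𝓛⁻⁹`, sign `+` (OBJECTIVE §1.3, last paragraph) — lives outside every calculus and is not typed.

## Contents

* `familyJumpBlock κ` + `familyJumpBlock_decided κ` (by `KnifeEdge.jumpMainTerm_nonneg`) +
  `rplus_jump_decided κ : ClassDecided (Rplus ++ [familyJumpBlock κ])`; and the KERNEL-UNIFORM packaging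
  `familyJumpBlockAll` (Design = `(ℝ → ℝ) × JumpData`, the kernel a coordinate of the design) +
  `familyJumpBlockAll_decided` + `rplus_jumpAll_decided` — ONE family for the running assembly, no `κ` to pick.
* C2 (no jumps ⇒ `R̄`-shape): `JumpData.ofKinked u u′` (no steps), `admissible_ofKinked`,
  `jumpMainTerm_ofKinked : jumpMainTerm κ (ofKinked u u′) = 𝔅(u)` (`KnifeEdge.jumpMainTerm_of_isEmpty`),
  `familyJumpBlock_verdict_ofKinked` (holds with NO slot: `mainTermForm_nonneg_of_isH1`), and
  `admissible_ofInClass` for `KnifeEdge.InClassPiece` data (the `u` of the two-piece families).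
* C4 (non-vacuity; modelled on B-multi designs multi-jump-001 / multi-jump-002, B-multi/designs/): `jumpOne`
  — continuous part Zhang's `ϰ₁ = ϰ(0.504, 3/2)` (`Repair.kappaP`), ONE interior jump at `z₀ = 9/20` with
  balanced amplitude `1/10`; `jumpTwo` — the same continuous part, TWO interior jumps at `2/5` (amplitude
  `13/63`) and `9/20` (amplitude `1/10`); `admissible_jumpOne`, `admissible_jumpTwo`; a jump at the wall is
  NOT in the class (`not_admissible_wallJump`).
* C4bis (v2 append, B-multi intake text of record KILL-draft v2.1 §6 «multi-jump-003 BPRZ archetype (M1)»):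
  `jumpBPRZ` — the design multi-jump-003 VERBATIM: side-1 piece `e^{iπ(3/2)(2/5−z)}𝟙_{[0,2/5)}` =
  `bprzCont + 1·𝟙_{[0,2/5)}` (`jumpBPRZ_profile_one`), `kinkedProfile_bprzCont`, `admissible_jumpBPRZ`,
  `verdict_jumpBPRZ` (model constant `𝔅(u₃) + κ(2/5)`).
* Tightness (the slot is load-bearing, disprover `_false_without_` shape): `jumpMainTerm_jumpStar`,
  `jumpCloses_of_neg_kernel` — with `g⋆` (`Repair.gStar`, `RepairRplusTightness.mainTermForm_gStar : 𝔅(g⋆) = 0`)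
  as continuous part and one balanced step at `1/2`, ANY kernel with `κ(1/2) < 0` gives a negative model
  constant (`KnifeEdge.JumpCloses κ`); conversely `kernel_neg_of_verdict_fails` (=
  `KnifeEdge.exists_kernel_neg_of_jumpCloses`): an admissible datum with negative constant forces `κ < 0` at
  an interior height.

Numerical certificates consumed: none (structural; rational jump data by `norm_num`).

## References

* Y. Zhang, arXiv:2211.02515v1 (2022), §2 (2.16)–(2.20), (2.32)–(2.33); §7 Prop. 7.1, (7.2); §8 (8.3);
  §10 Lemma 10.1, (10.5), (10.11). [cite: Zhang2022LandauSiegel, §§2, 7, 8, 10]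
-/

noncomputable section

open Real Complex ComplexConjugate Set

namespace Literature.NumberTheory.LFunctions.Zhang2022

namespace Repair

open KnifeEdge

variable {κ : ℝ → ℝ}

/-! ### The family (kernel as a parameter) and its kernel-uniform packaging -/

/-- family «B-multi M1 interior jumps, balanced MODEL main-term currency, kernel-sign slot displayed in the
verdict» for a kernel parameter `κ`. [cite: Zhang2022LandauSiegel, §7 Prop. 7.1 (7.2); §10 Lemma 10.1 (10.5)] -/
def familyJumpBlock (κ : ℝ → ℝ) : DesignFamily where
  Design := JumpData
  InClass J := J.Admissible
  Verdict J := (∀ z ∈ Ioo (0:ℝ) 1, 0 ≤ κ z) → 0 ≤ jumpMainTerm κ J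

/-- **M1 is decided** (for every kernel): the balanced model constant of an admissible interior-jump datum is
`≥ 0` whenever the kernel is `≥ 0` on `(0,1)` — `KnifeEdge.jumpMainTerm_nonneg` (p458438: `𝔅(u) ≥ 0` on kinked
profiles plus a non-negative jump sum). [cite: Zhang2022LandauSiegel, §7 Prop. 7.1 (7.2); §10 Lemma 10.1 (10.5)] -/
theorem familyJumpBlock_decided (κ : ℝ → ℝ) : (familyJumpBlock κ).Decided :=
  fun _ hJ hκ => jumpMainTerm_nonneg hκ hJ

/-- Unbundled form: every hypothesis a binder. [cite: Zhang2022LandauSiegel, §7 Prop. 7.1 (7.2); §10 (10.5)] -/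
theorem not_jumpCloses_in_familyJumpBlock {J : JumpData} (hJ : J.Admissible)
    (hκ : ∀ z ∈ Ioo (0:ℝ) 1, 0 ≤ κ z) : ¬ (jumpMainTerm κ J < 0) :=
  not_lt.2 (familyJumpBlock_decided κ J hJ hκ)

/-- When the slot is discharged by the row's claimed sign `KnifeEdge.JumpKernelPos κ` the verdict holds outright.
[cite: Zhang2022LandauSiegel, §10 Lemma 10.1 (10.5)] -/
theorem familyJumpBlock_verdict_of_jumpKernelPos (hκ : JumpKernelPos κ) {J : JumpData} (hJ : J.Admissible) :
    0 ≤ jumpMainTerm κ J :=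
  jumpMainTerm_nonneg (fun z hz => (hκ z hz).le) hJ

/-- **`R⁺ ++ [M1(κ)]` is decided.** [cite: Zhang2022LandauSiegel, §2 (2.32)–(2.33); §7 Prop. 7.1 (7.2)] -/
theorem rplus_jump_decided (κ : ℝ → ℝ) : ClassDecided (Rplus ++ [familyJumpBlock κ]) :=
  rplus_extend (familyJumpBlock_decided κ)

/-- The KERNEL-UNIFORM family: the (underived) kernel is a coordinate of the design, so ONE family covers every
kernel the derivation D-multi-2 might deliver; same class and verdict. [cite: Zhang2022LandauSiegel, §7 Prop. 7.1 (7.2); §10 (10.5)] -/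
def familyJumpBlockAll : DesignFamily where
  Design := (ℝ → ℝ) × JumpData
  InClass p := p.2.Admissible
  Verdict p := (∀ z ∈ Ioo (0:ℝ) 1, 0 ≤ p.1 z) → 0 ≤ jumpMainTerm p.1 p.2

/-- The kernel-uniform family is decided. [cite: Zhang2022LandauSiegel, §7 Prop. 7.1 (7.2); §10 (10.5)] -/
theorem familyJumpBlockAll_decided : familyJumpBlockAll.Decided := fun _ hJ hκ => jumpMainTerm_nonneg hκ hJ

/-- Membership / verdict of the kernel-uniform family are those of `familyJumpBlock κ` at the kernel coordinate.
[cite: Zhang2022LandauSiegel, §7 Prop. 7.1 (7.2)] -/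
theorem familyJumpBlockAll_iff (κ : ℝ → ℝ) (J : JumpData) :
    (familyJumpBlockAll.InClass (κ, J) ↔ (familyJumpBlock κ).InClass J) ∧
      (familyJumpBlockAll.Verdict (κ, J) ↔ (familyJumpBlock κ).Verdict J) :=
  ⟨Iff.rfl, Iff.rfl⟩

/-- **`R⁺ ++ [M1, all kernels]` is decided** (the form the running assembly appends).
[cite: Zhang2022LandauSiegel, §2 (2.32)–(2.33); §7 Prop. 7.1 (7.2)] -/
theorem rplus_jumpAll_decided : ClassDecided (Rplus ++ [familyJumpBlockAll]) :=
  rplus_extend familyJumpBlockAll_decided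

/-! ### C2 — no jumps: the class contains the one-sided `R̄` profiles and the verdict is `0 ≤ 𝔅(u)` -/

/-- A kinked profile with NO steps, as a jump datum. [cite: Zhang2022LandauSiegel, §7 Prop. 7.1 (7.2)] -/
def JumpData.ofKinked (u u' : ℝ → ℂ) : JumpData where
  n := 0
  cont := u
  cont' := u'
  pos := Fin.elim0
  coef := Fin.elim0

/-- It is admissible as soon as `u` is a one-sided kinked profile (`u(1) = 0`).
[cite: Zhang2022LandauSiegel, §7 Prop. 7.1 (7.2)] -/
theorem admissible_ofKinked {u u' : ℝ → ℂ} (hu : KinkedProfile u u') (h1 : u 1 = 0) :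
    (JumpData.ofKinked u u').Admissible :=
  ⟨hu, h1, fun i => i.elim0⟩

/-- An in-class piece of the two-piece families (`KnifeEdge.InClassPiece`) is such a datum.
[cite: Zhang2022LandauSiegel, §7 Prop. 7.1 (7.2)] -/
theorem admissible_ofInClass {u u' : ℝ → ℂ} (hu : InClassPiece u u') : (JumpData.ofKinked u u').Admissible :=
  admissible_ofKinked hu.kinked (hu.vanish 1 le_rfl)

/-- Without jumps the model constant is `𝔅(u)` (`KnifeEdge.jumpMainTerm_of_isEmpty`), for EVERY kernel.
[cite: Zhang2022LandauSiegel, §7 Prop. 7.1 (7.2)] -/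
theorem jumpMainTerm_ofKinked (κ : ℝ → ℝ) (u u' : ℝ → ℂ) :
    jumpMainTerm κ (JumpData.ofKinked u u') = mainTermForm u u' :=
  haveI : IsEmpty (Fin (JumpData.ofKinked u u').n) := ⟨fun i => i.elim0⟩
  jumpMainTerm_of_isEmpty κ _

/-- … so on the no-jump part the verdict is the `R̄` statement `0 ≤ 𝔅(u)` and holds with NO slot
(`MainTermFormH1.mainTermForm_nonneg_of_isH1`). [cite: Zhang2022LandauSiegel, §2 (2.32); §7 Prop. 7.1 (7.2)] -/
theorem familyJumpBlock_verdict_ofKinked (κ : ℝ → ℝ) {u u' : ℝ → ℂ} (hu : KinkedProfile u u') :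
    0 ≤ jumpMainTerm κ (JumpData.ofKinked u u') := by
  rw [jumpMainTerm_ofKinked]
  exact mainTermForm_nonneg_of_isH1 hu.isH1

/-! ### C4 — the class is inhabited by the B-multi M1 designs (multi-jump-001 / multi-jump-002 shapes) -/

/-- Modelled on B-multi design multi-jump-001: continuous part Zhang's `ϰ₁ = ϰ(0.504, 3/2)` ((2.23)), ONE interior
jump at `z₀ = 9/20` with balanced amplitude `1/10`. [cite: Zhang2022LandauSiegel, §2 (2.23); §7 (7.2)] -/
def jumpOne : JumpData where
  n := 1
  cont := kappaP (63 / 125) (3 / 2)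
  cont' := kappaP' (63 / 125) (3 / 2)
  pos := fun _ => 9 / 20
  coef := fun _ => 1 / 10

/-- Modelled on B-multi design multi-jump-002 (+ 001): the same continuous part, TWO interior jumps, at `2/5`
(amplitude `13/63`) and at `9/20` (amplitude `1/10`). [cite: Zhang2022LandauSiegel, §2 (2.23); §7 (7.2)] -/
def jumpTwo : JumpData where
  n := 2
  cont := kappaP (63 / 125) (3 / 2)
  cont' := kappaP' (63 / 125) (3 / 2)
  pos := ![2 / 5, 9 / 20]
  coef := ![13 / 63, 1 / 10]

/-- `jumpOne` is admissible (`ϰ(0.504, 3/2)` is a kinked profile with `ϰ(1) = 0`; `9/20 ∈ (0,1)`).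
[cite: Zhang2022LandauSiegel, §2 (2.23); §7 (7.2)] -/
theorem admissible_jumpOne : jumpOne.Admissible where
  kinked := kinkedProfile_kappaP (by norm_num) (by norm_num)
  top := kappaP_of_ge (by norm_num) (by norm_num)
  interior := fun _ => by change (9 / 20 : ℝ) ∈ Ioo (0:ℝ) 1; constructor <;> norm_num

/-- `jumpTwo` is admissible. [cite: Zhang2022LandauSiegel, §2 (2.23); §7 (7.2)] -/
theorem admissible_jumpTwo : jumpTwo.Admissible where
  kinked := kinkedProfile_kappaP (by norm_num) (by norm_num)
  top := kappaP_of_ge (by norm_num) (by norm_num)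
  interior := fun i => by
    fin_cases i
    · show (2 / 5 : ℝ) ∈ Ioo (0:ℝ) 1
      constructor <;> norm_num
    · show (9 / 20 : ℝ) ∈ Ioo (0:ℝ) 1
      constructor <;> norm_num

/-- The two designs are members of the class, for every kernel. [cite: Zhang2022LandauSiegel, §7 (7.2)] -/
theorem inClass_jump_examples (κ : ℝ → ℝ) :
    (familyJumpBlock κ).InClass jumpOne ∧ (familyJumpBlock κ).InClass jumpTwo :=
  ⟨admissible_jumpOne, admissible_jumpTwo⟩

/-- … and the verdict holds for them under the displayed slot. [cite: Zhang2022LandauSiegel, §7 (7.2); §10 (10.5)] -/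
theorem verdict_jump_examples (hκ : ∀ z ∈ Ioo (0:ℝ) 1, 0 ≤ κ z) :
    0 ≤ jumpMainTerm κ jumpOne ∧ 0 ≤ jumpMainTerm κ jumpTwo :=
  ⟨jumpMainTerm_nonneg hκ admissible_jumpOne, jumpMainTerm_nonneg hκ admissible_jumpTwo⟩

/-- A jump AT THE WALL `z = 1` is not in the class (that is B-multi M3 / rows E-005, E-034).
[cite: Zhang2022LandauSiegel, §7 (7.2)] -/
theorem not_admissible_wallJump (u u' : ℝ → ℂ) (c : ℂ) :
    ¬ (⟨1, u, u', fun _ => 1, fun _ => c⟩ : JumpData).Admissible := fun h => by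
  have := (h.interior 0).2
  change (1:ℝ) < 1 at this
  exact lt_irrefl _ this

/-! ### Tightness — the kernel-sign slot is load-bearing -/

/-- The kernel mode `g⋆` with one balanced step of amplitude `1` at height `1/2`.
[cite: Zhang2022LandauSiegel, §7 Prop. 7.1 (7.2)] -/
def jumpStar : JumpData where
  n := 1
  cont := gStar
  cont' := gStar'
  pos := fun _ => 1 / 2
  coef := fun _ => 1

/-- `jumpStar` is admissible (`g⋆` is an in-class piece: `KnifeEdge.inClassPiece_gStar`).
[cite: Zhang2022LandauSiegel, §7 Prop. 7.1 (7.2)] -/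
theorem admissible_jumpStar : jumpStar.Admissible where
  kinked := inClassPiece_gStar.kinked
  top := inClassPiece_gStar.vanish 1 le_rfl
  interior := fun _ => by change (1 / 2 : ℝ) ∈ Ioo (0:ℝ) 1; constructor <;> norm_num

/-- Its model constant is the kernel value `κ(1/2)` (`𝔅(g⋆) = 0`: `mainTermForm_gStar`, p456612).
[cite: Zhang2022LandauSiegel, §7 Prop. 7.1 (7.2); §10 (10.5)] -/
theorem jumpMainTerm_jumpStar (κ : ℝ → ℝ) : jumpMainTerm κ jumpStar = κ (1 / 2) := by
  rw [jumpMainTerm]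
  change mainTermForm gStar gStar' + ∑ i : Fin 1, ‖(1:ℂ)‖ ^ 2 * κ (1 / 2) = κ (1 / 2)
  rw [mainTermForm_gStar]
  simp

/-- **The slot is load-bearing**: ANY kernel negative at one interior height (here `1/2`) lets an admissible M1
datum close in the model currency (`KnifeEdge.JumpCloses κ`) — the verdict of `familyJumpBlock` is not a
consequence of membership alone. [cite: Zhang2022LandauSiegel, §7 Prop. 7.1 (7.2); §10 (10.5)] -/
theorem jumpCloses_of_neg_kernel (hκ : κ (1 / 2) < 0) : JumpCloses κ :=
  ⟨jumpStar, admissible_jumpStar, by rw [jumpMainTerm_jumpStar]; exact hκ⟩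

/-- … e.g. the constant kernel `−1` closes. [cite: Zhang2022LandauSiegel, §10 (10.5)] -/
theorem jumpCloses_neg_one : JumpCloses fun _ => -1 := jumpCloses_of_neg_kernel (by norm_num)

/-- Conversely (`KnifeEdge.exists_kernel_neg_of_jumpCloses`): a member violating the verdict's conclusion forces
`κ < 0` at an interior height — exactly the negation of the row's sign claim. [cite: Zhang2022LandauSiegel, §10 (10.5)] -/
theorem kernel_neg_of_verdict_fails {J : JumpData} (hJ : J.Admissible) (h : jumpMainTerm κ J < 0) :
    ∃ z ∈ Ioo (0:ℝ) 1, κ z < 0 :=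
  exists_kernel_neg_of_jumpCloses ⟨J, hJ, h⟩

/-! ### C4bis (v2) — the B-multi intake's named M1 witness multi-jump-003 (BPRZ archetype), verbatim -/

section BPRZ

open _root_.MeasureTheory


/-- The twist frequency `3π/2` of the side-1 piece of multi-jump-003 (`e^{iπ(3/2)(2/5 − z)}`).
[cite: Zhang2022LandauSiegel, §2 (2.23)] -/
def bprzFreq : ℝ := 3 / 2 * π

/-- The smooth formula `e^{iπ(3/2)(2/5 − y)} − 1` (vanishing at `y = 2/5`).
[cite: Zhang2022LandauSiegel, §2 (2.23)] -/
def bprzCore (y : ℝ) : ℂ := cexp (((bprzFreq * (2 / 5 - y) : ℝ) : ℂ) * I) - 1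

/-- Its derivative `−(3π/2)i·e^{iπ(3/2)(2/5 − y)}`. [cite: Zhang2022LandauSiegel, §2 (2.23)] -/
def bprzCore' (y : ℝ) : ℂ := cexp (((bprzFreq * (2 / 5 - y) : ℝ) : ℂ) * I) * ((((-bprzFreq) : ℝ) : ℂ) * I)

/-- The continuous part of multi-jump-003: `u₃ = (e^{iπ(3/2)(2/5−y)} − 1)·𝟙_{y < 2/5}` (so that
`u₃ + 1·𝟙_{[0,2/5)}` IS the design's side-1 piece `e^{iπ(3/2)(2/5−z)}𝟙_{[0,2/5)}`, twist `3/2`, sharp cut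
at `2/5` with jump `η = 1`). [cite: Zhang2022LandauSiegel, §2 (2.23); §7 (7.2)] -/
def bprzCont (y : ℝ) : ℂ := if 2 / 5 ≤ y then 0 else bprzCore y

/-- Its marked right derivative. [cite: Zhang2022LandauSiegel, §2 (2.23)] -/
def bprzCont' (y : ℝ) : ℂ := if 2 / 5 ≤ y then 0 else bprzCore' y

/-- `bprzCore` is continuous. [cite: Zhang2022LandauSiegel, §2 (2.23)] -/
theorem continuous_bprzCore : Continuous bprzCore := by unfold bprzCore; fun_prop

/-- `bprzCore' ` is continuous. [cite: Zhang2022LandauSiegel, §2 (2.23)] -/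
theorem continuous_bprzCore' : Continuous bprzCore' := by unfold bprzCore'; fun_prop

/-- `bprzCore (2/5) = 0`. [cite: Zhang2022LandauSiegel, §2 (2.23)] -/
theorem bprzCore_cut : bprzCore (2 / 5) = 0 := by simp [bprzCore]

/-- derivative of the smooth formula. [cite: Zhang2022LandauSiegel, §2 (2.23)] -/
theorem hasDerivAt_bprzCore (y : ℝ) : HasDerivAt bprzCore (bprzCore' y) y := by
  have h1 : HasDerivAt (fun x : ℝ => ((bprzFreq * (2 / 5 - x) : ℝ) : ℂ)) (((-bprzFreq : ℝ) : ℂ)) y := by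
    have hr : HasDerivAt (fun x : ℝ => bprzFreq * (2 / 5 - x)) (-bprzFreq) y := by
      simpa using ((hasDerivAt_id y).const_sub (2 / 5 : ℝ)).const_mul bprzFreq
    exact hr.ofReal_comp
  have h2 := (h1.mul_const I).cexp
  have h3 := h2.sub_const (1 : ℂ)
  unfold bprzCore bprzCore'
  convert h3 using 1

/-- `u₃` is continuous (the two branches agree at the cut). [cite: Zhang2022LandauSiegel, §2 (2.23)] -/
theorem continuous_bprzCont : Continuous bprzCont := by
  unfold bprzCont
  refine Continuous.if_le continuous_const continuous_bprzCore continuous_const continuous_id ?_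
  intro a ha
  rw [← ha, bprzCore_cut]

/-- `‖u₃′‖ ≤ 3π/2`. [cite: Zhang2022LandauSiegel, §2 (2.23)] -/
theorem norm_bprzCont'_le (y : ℝ) : ‖bprzCont' y‖ ≤ bprzFreq := by
  have hpos : 0 ≤ bprzFreq := by unfold bprzFreq; positivity
  unfold bprzCont'
  split_ifs
  · simpa using hpos
  · unfold bprzCore'
    rw [norm_mul, Complex.norm_exp_ofReal_mul_I, one_mul, norm_mul, Complex.norm_I, mul_one,
      Complex.norm_real, Real.norm_eq_abs, abs_neg, abs_of_nonneg hpos]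

/-- `u₃` is a one-sided kinked profile. [cite: Zhang2022LandauSiegel, §2 (2.23); §7 Prop 7.1 (7.2)] -/
theorem kinkedProfile_bprzCont : KinkedProfile bprzCont bprzCont' where
  cont := continuous_bprzCont.continuousOn
  hasDeriv := by
    intro x hx
    by_cases hcut : 2 / 5 ≤ x
    · -- beyond the cut: `u₃ = 0` on `[x, ∞)`
      have h0 : HasDerivWithinAt (fun _ : ℝ => (0:ℂ)) 0 (Ioi x) x := hasDerivWithinAt_const x (Ioi x) 0
      have hval : bprzCont' x = 0 := by simp [bprzCont', hcut]
      rw [hval]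
      refine h0.congr (fun y hy => ?_) ?_
      · have : 2 / 5 ≤ y := hcut.trans (le_of_lt hy)
        simp [bprzCont, this]
      · simp [bprzCont, hcut]
    · -- below the cut: `u₃ = bprzCore` near `x`
      replace hcut : x < 2 / 5 := not_le.1 hcut
      have hev : bprzCont =ᶠ[nhds x] bprzCore := by
        filter_upwards [Iio_mem_nhds hcut] with y hy
        simp [bprzCont, not_le.2 (show y < 2 / 5 from hy)]
      have hd : HasDerivAt bprzCont (bprzCore' x) x := (hasDerivAt_bprzCore x).congr_of_eventuallyEq hev
      have hval : bprzCont' x = bprzCore' x := by simp [bprzCont', not_le.2 hcut]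
      rw [hval]
      exact hd.hasDerivWithinAt
  memLp := by
    have hmeas : Measurable bprzCont' := by
      unfold bprzCont'
      exact Measurable.ite measurableSet_Ici measurable_const continuous_bprzCore'.measurable
    exact MemLp.of_bound hmeas.aestronglyMeasurable bprzFreq (Filter.Eventually.of_forall norm_bprzCont'_le)

/-- **B-multi design multi-jump-003 (the BPRZ archetype) as a jump datum, verbatim**: side-1 profile
`e^{iπ(3/2)(2/5−z)}𝟙_{[0,2/5)}` = `u₃ + 1·𝟙_{[0,2/5)}`, ONE interior jump at `2/5` with balanced amplitude `1`.
[cite: Zhang2022LandauSiegel, §2 (2.23); §7 (7.2)] -/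
def jumpBPRZ : JumpData where
  n := 1
  cont := bprzCont
  cont' := bprzCont'
  pos := fun _ => 2 / 5
  coef := fun _ => 1

/-- The balanced profile of `jumpBPRZ` at scale `Λ = 1` IS the design's side-1 piece on `[0, ∞)`:
`u₃(z) + 𝟙_{[0,2/5)}(z) = e^{iπ(3/2)(2/5−z)}` for `0 ≤ z < 2/5` and `= 0` for `z ≥ 2/5`.
[cite: Zhang2022LandauSiegel, §2 (2.23); §7 (7.2)] -/
theorem jumpBPRZ_profile_one {z : ℝ} (hz : 0 ≤ z) :
    jumpBPRZ.profile 1 z = if z < 2 / 5 then cexp (((bprzFreq * (2 / 5 - z) : ℝ) : ℂ) * I) else 0 := by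
  unfold JumpData.profile jumpBPRZ
  simp only [Finset.univ_unique, Fin.default_eq_zero, Finset.sum_singleton, Real.sqrt_one, inv_one,
    Complex.ofReal_one, mul_one, one_mul]
  by_cases h : z < 2 / 5
  · rw [if_pos h, stepFun_of_mem ⟨hz, h⟩]
    simp [bprzCont, not_le.2 h, bprzCore]
  · rw [if_neg h, stepFun_of_not_mem (fun hm => h hm.2)]
    simp [bprzCont, not_lt.1 h]

/-- `jumpBPRZ` is admissible (M1: `u₃` kinked, `u₃(1) = 0`, jump at `2/5 ∈ (0,1)`).
[cite: Zhang2022LandauSiegel, §2 (2.23); §7 (7.2)] -/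
theorem admissible_jumpBPRZ : jumpBPRZ.Admissible where
  kinked := kinkedProfile_bprzCont
  top := by change bprzCont 1 = 0; rw [bprzCont, if_pos (by norm_num)]
  interior := fun _ => by change (2 / 5 : ℝ) ∈ Ioo (0:ℝ) 1; constructor <;> norm_num

/-- … so the verdict of `familyJumpBlock` / `familyJumpBlockAll` holds on it under the displayed slot; its
model constant is `𝔅(u₃) + κ(2/5)`. [cite: Zhang2022LandauSiegel, §7 (7.2); §10 (10.5)] -/
theorem verdict_jumpBPRZ {κ : ℝ → ℝ} (hκ : ∀ z ∈ Ioo (0:ℝ) 1, 0 ≤ κ z) :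
    0 ≤ jumpMainTerm κ jumpBPRZ ∧ jumpMainTerm κ jumpBPRZ = mainTermForm bprzCont bprzCont' + κ (2 / 5) := by
  refine ⟨jumpMainTerm_nonneg hκ admissible_jumpBPRZ, ?_⟩
  rw [jumpMainTerm]
  change mainTermForm bprzCont bprzCont' + ∑ i : Fin 1, ‖(1:ℂ)‖ ^ 2 * κ (2 / 5) = _
  simp

end BPRZ

end Repair

end Literature.NumberTheory.LFunctions.Zhang2022
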